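import Summits.BirchSwinnertonDyer.Rank1Residual.X2.ClassClosureOfFacts
import Summits.BirchSwinnertonDyer.Rank1Residual.X2.GreenbergVatsalOfDerivedProp510
import HarnessLib

/-!
# Class X2 — the class theorem of record modulo named residues, with the two DERIVED facts
# (A196 = GV Thm. (3.11)+(28)+p. 43 transcribed, gen 21; A61 = Greenberg Prop. 5.10, gen 22) UNFOLDED
# into their registered sources (cell `b2b-bsdres`, unit `b2b-bsdres-eisenstein-p2`, gen 22;
# corollary file of gen 19's `ClassClosureOfFacts.lean`; consumers: CLASS-CLOSURE lane rows N9 / O9)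

HONEST FRAMING (run/shared/lean/b2b/bsd-rank1-residual/, verbatim in every file): the goal of the
cell is to DELETE the COMBINATION-SHAPED residual classes of the Birch–Swinnerton-Dyer formula for
ALL analytic-rank `≤ 1` elliptic curves over `ℚ` — "full BSD formula for every rank `≤ 1` curve in
class `C`" assembled STRICTLY from published theorems — so that the rank-`≤ 1` remainder becomes
exactly the CONSTRUCTION-SHAPED classes, which are TYPED (missing-input `Prop`s), NOT attempted.
This is not "finishing BSD". Research route; NO CLAIM BEYOND STATED CLASSES; nothing here changes
a label (the seat proposes, the referee rules); X2b/X2c stay CONSTRUCTION-SHAPED. Theorems only: no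
definition, no new named fact; every published input enters as one of the tree's existing named
Literature facts BY NAME; the residues enter as explicit per-pair hypotheses.

WHAT. Gen 19's `target_of_facts_of_residues` (and its two companions) take, among the registered
facts, `hG` = A61 (Greenberg LNM 1716 Prop. 5.10) and `hAnF` = A196 (GV Thm. (3.11)+(28)+p. 43 read
at `p ‖ N`). Both are now DERIVED terms: A196 ⇐ {A40, A41, F0, F1, F2, F3} (gen 21
`nonPrimitive_unitContent_and_lambda_eq_residual_of_lineRamifiedEven_of_facts`) and A61 ⇐
{A40, A41, F0, F2, F3} (gen 22 `prop510_isTorsion_hasUnitContent_of_gvPar_of_facts`). This file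
restates the class theorem of record with those two binders discharged, so that its registered
inputs are literally: A40/A41 (Tate uniformisation), A133/A135/A137 (GV §§1–2 numbered statements
at `p ‖ N`), A195 (GV p. 28/30 lifting), A180 (GV Cor. (3.8)), F0 (Kubota–Leopoldt existence),
F1 (GV Thm. (3.11)+(28), good-ordinary-or-multiplicative), F2/F3 (Ferrero–Washington + Mazur–Wiles
character identities), A33 (Wuthrich Thm. 16), and the rank-`≤ 1` assembly facts (Jones/SW 6.1,
canonical heights, GZK, modularity, parametrisation, Greenberg–Stevens, Disegni) — plus EXACTLY the
per-pair residues of gen 19 (X2a none · X2b MC · X2c-ns (GVPar ∨ MC) ∧ Schneider · X2c-s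
(GVPar ∨ MC) ∧ `O9.ExceptionalLeadingTermAt` ∧ Schneider).

* `mazurMainConjectureAt_of_gvPar_of_derivedFacts`, `target_of_derivedFacts_of_residues`,
  `bsdp_of_classX2_of_gvPar_of_derivedFacts`.

References: [GreenbergVatsal2000] Thm. (1.3), §2 pp. 26–30, §3 Thm. (3.11), (26)–(28), pp. 41–43,
Cor. (3.8); [GreenbergLNM1716] Prop. 5.10 (PDF pp. 147–148); [Wuthrich2014] Thm. 16; [Disegni2020]
Thm. 4; HOME/b2b-bsdres-eisenstein-p2/X2-GAP.md §26–§27; HOME/class-closure/O9/.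
-/

set_option autoImplicit false

noncomputable section

open scoped Classical MatrixGroups ModularForm

open PowerSeries CongruenceSubgroup WeierstrassCurve Literature.NumberTheory.EllipticCurves
  Literature.NumberTheory.EllipticCurves.ModularForms
  Literature.NumberTheory.EllipticCurves.Rank1Residual
  Literature.NumberTheory.EllipticCurves.Rank1Residual.Typed
  Literature.NumberTheory.EllipticCurves.GreenbergVatsal2000
  Literature.NumberTheory.EllipticCurves.Wuthrich2014
  Literature.NumberTheory.EllipticCurves.SteinWuthrich2013
  Literature.NumberTheory.EllipticCurves.Disegni2020
  Summit.BirchSwinnertonDyer.Rank1Residual.X2.GreenbergVatsalInputsOfFacts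
  Summit.BirchSwinnertonDyer.Rank1Residual.X2.EisensteinCongruenceOfFacts
  Summit.BirchSwinnertonDyer.Rank1Residual.X2.GreenbergProp510OfFacts

namespace Summit.BirchSwinnertonDyer.Rank1Residual.X2

/-- **Mazur's main conjecture at every odd multiplicative pair of GV parity, from registered facts
with A196 and A61 DERIVED** (gen 19's `mazurMainConjectureAt_of_gvPar_of_facts`, binders `hG`, `hAnF`
discharged by gens 22/21). [cite: GreenbergVatsal2000, Thm. (1.3) with §2 pp. 28–30, §3 Thm. (3.11), (28), p. 43, Cor. (3.8)]
[cite: GreenbergLNM1716, Prop. 5.10 (PDF pp. 147–148)] [cite: Wuthrich2014, Thm. 16 (p. 397)] -/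
theorem mazurMainConjectureAt_of_gvPar_of_derivedFacts
    (hT : Silverman1994_thmV53_tateUniformisation.{0})
    (hT' : Silverman1994_thmV53_corV54_tateUniformisation.{0})
    (hA : lambda_nonPrimitive_eq_add_sum_delta_multiplicative)
    (hB : datumSelmer_divisible_of_finite_torsionBy)
    (hF : datumStrictSelmer_lt_datumSelmer_of_split)
    (hLiftF : residualEpsilon_surjOn_of_lineRamifiedEven)
    (hP : cor38_realPeriodRat_eq_unit_mul_of_isIsogenous_of_gvPar)
    (hEx : exists_characterLFunction)
    (h311 : thm311_hasUnitContent_iff_and_order_eq_of_lineRamifiedEven)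
    (hC : characterLFunctionC_hasUnitContent_and_order_eq_card)
    (hD : characterLFunctionD_hasUnitContent_and_order_eq_card)
    (hWu : thm16_charIdeal_dvd_multiplicative_of_reducible)
    (W : WeierstrassCurve ℚ) [W.IsElliptic] [W.IsGloballyMinimal] (p : ℕ) [Fact p.Prime]
    (hp : p ≠ 2) (hmult : W.HasMultiplicativeReductionAtPrime p) (hgv : GVPar W p) :
    MazurMainConjectureAt W p :=
  mazurMainConjectureAt_of_gvPar_of_facts hT hT' hA hB hF
    (GreenbergProp510OfFacts.prop510_isTorsion_hasUnitContent_of_gvPar_of_facts hT hT' hEx hC hD)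
    hLiftF
    (EisensteinCongruenceOfFacts.nonPrimitive_unitContent_and_lambda_eq_residual_of_lineRamifiedEven_of_facts
      hT hT' hEx h311 hC hD)
    hP hWu W p hp hmult hgv

/-- **THE CLASS THEOREM OF RECORD MODULO NAMED RESIDUES, with A196 and A61 unfolded into their
registered sources** — gen 19's `target_of_facts_of_residues` with `hG` (A61) and `hAnF` (A196)
discharged. Registered inputs: A40/A41, A133/A135/A137, A195, A180, F0/F1/F2/F3, A33, + the
rank-`≤ 1` assembly facts; per-pair residues exactly as in gen 19 (`hResB`, `hResCns`, `hResCs`).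
[cite: GreenbergVatsal2000, Thm. (1.3), §2 pp. 26–30, §3 Thm. (3.11), (26)–(28), pp. 41–43, Cor. (3.8)]
[cite: GreenbergLNM1716, Prop. 5.10 (PDF pp. 147–148)] [cite: Wuthrich2014, Thm. 16 (p. 397)]
[cite: Disegni2020, Thm. 4 (§3.2)] [cite: SteinWuthrich2013, Thm. 6.1 (p. 20)] -/
theorem target_of_derivedFacts_of_residues
    (hT : Silverman1994_thmV53_tateUniformisation.{0})
    (hT' : Silverman1994_thmV53_corV54_tateUniformisation.{0})
    (hA : lambda_nonPrimitive_eq_add_sum_delta_multiplicative)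
    (hB : datumSelmer_divisible_of_finite_torsionBy)
    (hF : datumStrictSelmer_lt_datumSelmer_of_split)
    (hLiftF : residualEpsilon_surjOn_of_lineRamifiedEven)
    (hP : cor38_realPeriodRat_eq_unit_mul_of_isIsogenous_of_gvPar)
    (hEx : exists_characterLFunction)
    (h311 : thm311_hasUnitContent_iff_and_order_eq_of_lineRamifiedEven)
    (hC : characterLFunctionC_hasUnitContent_and_order_eq_card)
    (hD : characterLFunctionD_hasUnitContent_and_order_eq_card)
    (hWu : thm16_charIdeal_dvd_multiplicative_of_reducible)
    (hJs : thm61_splitMultiplicative) (hJn : thm61_nonsplitMultiplicative)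
    (hHs : exists_isSplitMultCanonical) (hHn : exists_isMultCanonical)
    (hGZ : GrossZagier1986_thm_I_7_3) (hGZK : rank_eq_analyticRank_of_analyticRank_le_one)
    (hmod : hasEntireLFunction_rat) (hpar : nonempty_modularParametrizationData)
    (hGS : ∀ (W : WeierstrassCurve ℚ) [W.IsElliptic] [W.IsGloballyMinimal] (p : ℕ) [Fact p.Prime],
      greenberg_stevens (W := W) (p := p))
    (hDis : padicBSD_rankOne_nonsplitMult)
    (hResB : ∀ (W : WeierstrassCurve ℚ) [W.IsElliptic] [W.IsGloballyMinimal] (p : ℕ) [Fact p.Prime],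
      CellB W p → MazurMainConjectureAt W p)
    (hResCns : ∀ (W : WeierstrassCurve ℚ) [W.IsElliptic] [W.IsGloballyMinimal] (p : ℕ) [Fact p.Prime],
      CellC W p → ¬ W.HasSplitMultiplicativeReductionAtPrime p →
        (GVPar W p ∨ MazurMainConjectureAt W p) ∧
        ∀ (q : ℚ_[p]) (Dh : PAdicHeightData W p), q ≠ 0 → ‖q‖ < 1 → tateJ q = (W.j : ℚ_[p]) →
          IsMultCanonical Dh q → SchneiderConjecture Dh)
    (hResCs : ∀ (W : WeierstrassCurve ℚ) [W.IsElliptic] [W.IsGloballyMinimal] (p : ℕ) [Fact p.Prime],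
      CellC W p → W.HasSplitMultiplicativeReductionAtPrime p →
        (GVPar W p ∨ MazurMainConjectureAt W p) ∧ O9.ExceptionalLeadingTermAt W p ∧
        ∀ (Dq : TateParameterData W p) (Dh : PAdicHeightData W p),
          IsSplitMultCanonical Dh Dq → SchneiderConjecture Dh) :
    Target :=
  target_of_facts_of_residues hT hT' hA hB hF
    (GreenbergProp510OfFacts.prop510_isTorsion_hasUnitContent_of_gvPar_of_facts hT hT' hEx hC hD)
    hLiftF
    (EisensteinCongruenceOfFacts.nonPrimitive_unitContent_and_lambda_eq_residual_of_lineRamifiedEven_of_facts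
      hT hT' hEx h311 hC hD)
    hP hWu hJs hJn hHs hHn hGZ hGZK hmod hpar hGS hDis hResB hResCns hResCs

/-- **X2 per pair at GV parity: `BSD(E,p)` with the two derived facts unfolded** — gen 19's
`bsdp_of_classX2_of_gvPar_of_facts` with `hG`, `hAnF` discharged; residues only at rank one
(non-split: Schneider certificate; split: `O9.ExceptionalLeadingTermAt` ∧ Schneider).
[cite: GreenbergVatsal2000, Thm. (1.3) with §2 pp. 28–30, §3 Thm. (3.11), Cor. (3.8)]
[cite: Disegni2020, Thm. 4 (§3.2)] [cite: Wuthrich2014, Thm. 16 (p. 397)] -/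
theorem bsdp_of_classX2_of_gvPar_of_derivedFacts
    (hT : Silverman1994_thmV53_tateUniformisation.{0})
    (hT' : Silverman1994_thmV53_corV54_tateUniformisation.{0})
    (hA : lambda_nonPrimitive_eq_add_sum_delta_multiplicative)
    (hB : datumSelmer_divisible_of_finite_torsionBy)
    (hF : datumStrictSelmer_lt_datumSelmer_of_split)
    (hLiftF : residualEpsilon_surjOn_of_lineRamifiedEven)
    (hP : cor38_realPeriodRat_eq_unit_mul_of_isIsogenous_of_gvPar)
    (hEx : exists_characterLFunction)
    (h311 : thm311_hasUnitContent_iff_and_order_eq_of_lineRamifiedEven)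
    (hC : characterLFunctionC_hasUnitContent_and_order_eq_card)
    (hD : characterLFunctionD_hasUnitContent_and_order_eq_card)
    (hWu : thm16_charIdeal_dvd_multiplicative_of_reducible)
    (hJs : thm61_splitMultiplicative) (hJn : thm61_nonsplitMultiplicative)
    (hHs : exists_isSplitMultCanonical) (hHn : exists_isMultCanonical)
    (hGZ : GrossZagier1986_thm_I_7_3) (hGZK : rank_eq_analyticRank_of_analyticRank_le_one)
    (hmod : hasEntireLFunction_rat) (hpar : nonempty_modularParametrizationData)
    (W : WeierstrassCurve ℚ) [W.IsElliptic] [W.IsGloballyMinimal] (p : ℕ) [Fact p.Prime]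
    (hGS : greenberg_stevens (W := W) (p := p)) (hDis : padicBSD_rankOne_nonsplitMult)
    (hr : W.analyticRank ≤ 1) (hX : ClassX2 W p) (hgv : GVPar W p)
    (hSchNs : W.analyticRank = 1 → ¬ W.HasSplitMultiplicativeReductionAtPrime p →
      ∀ (q : ℚ_[p]) (Dh : PAdicHeightData W p), q ≠ 0 → ‖q‖ < 1 → tateJ q = (W.j : ℚ_[p]) →
        IsMultCanonical Dh q → SchneiderConjecture Dh)
    (hExcS : W.analyticRank = 1 → W.HasSplitMultiplicativeReductionAtPrime p →
      O9.ExceptionalLeadingTermAt W p ∧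
      ∀ (Dq : TateParameterData W p) (Dh : PAdicHeightData W p),
        IsSplitMultCanonical Dh Dq → SchneiderConjecture Dh) :
    BSDp W p :=
  bsdp_of_classX2_of_gvPar_of_facts hT hT' hA hB hF
    (GreenbergProp510OfFacts.prop510_isTorsion_hasUnitContent_of_gvPar_of_facts hT hT' hEx hC hD)
    hLiftF
    (EisensteinCongruenceOfFacts.nonPrimitive_unitContent_and_lambda_eq_residual_of_lineRamifiedEven_of_facts
      hT hT' hEx h311 hC hD)
    hP hWu hJs hJn hHs hHn hGZ hGZK hmod hpar W p hGS hDis hr hX hgv hSchNs hExcS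

end Summit.BirchSwinnertonDyer.Rank1Residual.X2

end
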